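import Summits.AtomisticToContinuum.FouriersLaw.Theorems.PuiseuxTransferLedgerFiniteResponseProfile
import Summits.AtomisticToContinuum.FouriersLaw.Theorems.PuiseuxTransferLedgerTwoModeBulkStubProfileSumRule

/-!
# The transfer-column representation of the kinetic-temperature response profile
(line `comonotone-local-resistance` of crux stmt-AtomisticToContinuum-9141 `OddSectorIrreversibility.BoundedResponseConverges`,
lead c3 — the kernel dictionary of the line)

For `P = pinnedChain ω₂ lam β γ` (all four `> 0`), `N + 1` sites `0..N`, `T > 0`, `μ₀ = gibbsMeasure (N+1) T`,
`K_t = transitionKernel (N+1) T T t` (both baths at `T`) and ANY site `i : Fin (N+1)`: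
`siteResponse_eq_transferColumn` — under weak-NESS uniqueness, along every steady-state family, the kinetic-temperature
response profile IS the left-bath transfer column minus one half,
  `θ_{N+1}(i) := lim_{δ→0,δ≠0} (μ_{N+1,T+δ/2,T-δ/2}(p_i²) - μ_{N+1,T,T}(p_i²))/δ = a_L(i) - 1/2`,
  `a_L(i) := (γ/T²) ∫₀^∞ Cov_{μ₀}(p_0², K_t p_i²) dt`.
Inputs (all landed): the KDN representation `θ = (γ/2T²)∫₀^∞ μ₀((p_0² − p_N²)·K_t p_i²)` (`siteResponse_tendsto` +
`gibbsTTCF_site`, stmt-12011) and the site sum rule `∫₀^∞ Cov(p_0², K_t p_i²) + ∫₀^∞ Cov(p_N², K_t p_i²) = T²/γ`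
(`TwoModeBulk.Sketch.stub_profileSumRule`, crux stmt-12111). Reading: `1/2 + θ(i) = a_L(i)`, `1/2 − θ(i) = a_R(i)`,
`a_L + a_R = 1` (the sum rule of `TransferKernelPositivity.Passivity`'s docstring, now a theorem); with `BoundaryKubo`
(`D_{N+1} = γ N a_L(N)`) and `ContactIdentity`, every LOCAL RESISTANCE of the line is a normalised decrement of ONE
equilibrium column, `r_i^{(N+1)} = (a_L(i) − a_L(i+1))/(γ a_L(N))`, so the line's three `N`-uniform stubs S1–S3 are
shape / two-length / fixed-depth statements about the equilibrium space-time covariances `Cov_{μ₀}(p_0², K_t p_i²)` of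
the OPEN chain at ONE temperature — no NESS, no `δ`, no uniqueness inside them. No definitions; standard axioms.
-/

noncomputable section

open scoped NNReal ENNReal Topology
open MeasureTheory Filter Set

namespace Summit.AtomisticToContinuum.FouriersLaw.Cruxes.BoundedResponseConverges.ComonotoneLocalResistance.Kernel

open Literature.MathematicalPhysics.KineticTheory.HeatConduction
open Literature.MathematicalPhysics.KineticTheory Literature.Probability.Process OscillatorChain
open ProbabilityTheory
open Summit.AtomisticToContinuum.FouriersLaw.Theorems.SubdiffusiveBondHeat
open Summit.AtomisticToContinuum.FouriersLaw.Theorems.IncoherentBounded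
open Summit.AtomisticToContinuum.FouriersLaw.Theorems.IncoherentChannel.Negative.GibbsStein (gibbs_sq_momentum)
open Summit.AtomisticToContinuum.FouriersLaw.Theorems.BoundaryKubo.Negative.LoadBearing
open Summit.AtomisticToContinuum.FouriersLaw.Theorems.BoundaryKubo.GibbsTtcf
open Summit.AtomisticToContinuum.FouriersLaw.Theorems.PuiseuxTransferLedgerFiniteResponseProfile (gibbsTTCF_site)

/-- **THE DICTIONARY: the kinetic-temperature response profile is the left-bath transfer column minus one half.**
Under weak-NESS uniqueness, along every steady-state family of the pinned anharmonic chain (all parameters `> 0`), for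
`T > 0`, `N` and every site `i` of the `(N+1)`-chain:
`(μ_{N+1,T+δ/2,T-δ/2}(p_i²) - μ_{N+1,T,T}(p_i²))/δ → (γ/T²) ∫₀^∞ Cov_{μ₀}(p_0², K_t p_i²) dt - 1/2` as `δ → 0`, `δ ≠ 0`.
Proof: the landed KDN representation (`siteResponse_tendsto` with the TTCF identity `gibbsTTCF_site`) gives the limit
`(γ/2T²)∫₀^∞ μ₀((p_0² - p_N²) K_t p_i²) = (γ/2T²)(∫Y_i - ∫X_i)`; the landed site sum rule `∫Y_i + ∫X_i = T²/γ`
(`TwoModeBulk.Sketch.stub_profileSumRule`, line `Sketch` of crux stmt-12111) turns it into `(γ/T²)∫Y_i - 1/2`. So `1/2 + θ(i) = a_L(i)`, `1/2 - θ(i) = a_R(i)`, `a_L + a_R = 1`. [folklore] -/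
theorem siteResponse_eq_transferColumn :
    ∀ ω₂ lam β γ : ℝ, 0 < ω₂ → 0 < lam → 0 < β → 0 < γ →
    (∀ (N : ℕ) (T_L T_R : ℝ), 0 < T_L → 0 < T_R → ∀ μ ν : Measure (PhaseSpace N),
      (pinnedChain ω₂ lam β γ).IsSteadyState N T_L T_R μ →
      (pinnedChain ω₂ lam β γ).IsSteadyState N T_L T_R ν → μ = ν) →
    ∀ μ : (N : ℕ) → ℝ → ℝ → Measure (PhaseSpace N),
      (∀ (N : ℕ) (T_L T_R : ℝ), 0 < T_L → 0 < T_R →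
        (pinnedChain ω₂ lam β γ).IsSteadyState N T_L T_R (μ N T_L T_R)) →
    ∀ T : ℝ, 0 < T → ∀ (N : ℕ) (i : Fin (N + 1)),
      Tendsto (fun δ : ℝ =>
          ((∫ x, (x.2 i) ^ 2 ∂(μ (N + 1) (T + δ / 2) (T - δ / 2))) - ∫ x, (x.2 i) ^ 2 ∂(μ (N + 1) T T)) / δ)
        (𝓝[≠] 0)
        (𝓝 (γ / T ^ 2 * (∫ t in Ioi (0 : ℝ), ((∫ z, (z.2 0) ^ 2 * (∫ y, (y.2 i) ^ 2 ∂((pinnedChain ω₂ lam β γ).transitionKernel (N + 1) T T t.toNNReal z)) ∂((pinnedChain ω₂ lam β γ).gibbsMeasure (N + 1) T)) - (∫ z, (z.2 0) ^ 2 ∂((pinnedChain ω₂ lam β γ).gibbsMeasure (N + 1) T)) * (∫ z, (∫ y, (y.2 i) ^ 2 ∂((pinnedChain ω₂ lam β γ).transitionKernel (N + 1) T T t.toNNReal z)) ∂((pinnedChain ω₂ lam β γ).gibbsMeasure (N + 1) T)))) - 1 / 2)) := by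
  intro ω₂ lam β γ hω hl hβ hγ hU μ hμ T hT N i
  -- notation
  set P := pinnedChain ω₂ lam β γ with hPdef
  have hP : P.IsConfining := pinnedChain_isConfining hω hl.le hβ.le hγ.le
  set μ₀ := P.gibbsMeasure (N + 1) T with hμ₀
  haveI : IsProbabilityMeasure μ₀ := pinnedChain_isProbabilityMeasure_gibbsMeasure hω hl.le hβ.le γ (N + 1) hT
  set K : ℝ≥0 → Kernel (PhaseSpace (N + 1)) (PhaseSpace (N + 1)) := P.transitionKernel (N + 1) T T with hK
  set Hm := P.hamiltonian (N + 1) with hHm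
  set A : PhaseSpace (N + 1) → ℝ := fun y => (y.2 i) ^ 2 with hA
  set B : PhaseSpace (N + 1) → ℝ := fun y => (y.2 0) ^ 2 with hB
  set C : PhaseSpace (N + 1) → ℝ := fun y => (y.2 (Fin.last N)) ^ 2 with hC
  set KA : ℝ → PhaseSpace (N + 1) → ℝ := fun t z => ∫ y, A y ∂(K t.toNNReal z) with hKA
  set X : ℝ → ℝ := fun t => (∫ z, C z * KA t z ∂μ₀) - (∫ z, C z ∂μ₀) * (∫ z, KA t z ∂μ₀) with hX
  set Y : ℝ → ℝ := fun t => (∫ z, B z * KA t z ∂μ₀) - (∫ z, B z ∂μ₀) * (∫ z, KA t z ∂μ₀) with hY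
  -- the site sum rule
  obtain ⟨hYint, hXint, hsum⟩ := Theorems.TwoModeBulk.Sketch.stub_profileSumRule ω₂ lam β γ hω hl hβ hγ N T hT i
  change IntegrableOn Y (Ioi 0) at hYint
  change IntegrableOn X (Ioi 0) at hXint
  change (∫ t in Ioi (0:ℝ), Y t) + (∫ t in Ioi (0:ℝ), X t) = T ^ 2 / γ at hsum
  show Tendsto (fun δ : ℝ =>
      ((∫ x, (x.2 i) ^ 2 ∂(μ (N + 1) (T + δ / 2) (T - δ / 2))) - ∫ x, (x.2 i) ^ 2 ∂(μ (N + 1) T T)) / δ)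
    (𝓝[≠] 0) (𝓝 (γ / T ^ 2 * (∫ t in Ioi (0 : ℝ), Y t) - 1 / 2))
  -- the KDN representation (landed)
  have h := Theorems.PuiseuxTransferLedgerFiniteResponseProfile.siteResponse_tendsto hω hl hβ hγ hU hμ hT N i
    (fun δ hδ S hS => gibbsTTCF_site hω hl hβ hγ N i hT hδ hS)
  have hTT : ∫ x, (x.2 i) ^ 2 ∂(μ (N + 1) T T) = T := by
    rw [steadyFamily_apply_self hω hl hβ hU hμ hT (N + 1)]
    exact gibbs_sq_momentum hω hl.le hβ.le hT i
  -- statics and Gibbs invariance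
  have hϑ0 : (0:ℝ) < 1 / (4 * T) := by positivity
  have hAc : Continuous A := by rw [hA]; fun_prop
  have hBc : Continuous B := by rw [hB]; fun_prop
  have hCc : Continuous C := by rw [hC]; fun_prop
  have hAb : ∀ y, |A y| ≤ 2 / (1 / (4 * T)) * Real.exp (1 / (4 * T) * Hm y) := fun y =>
    abs_sq_momentum_le_exp hP hϑ0 (N + 1) y _
  have hBb : ∀ y, |B y| ≤ 2 / (1 / (4 * T)) * Real.exp (1 / (4 * T) * Hm y) := fun y =>
    abs_sq_momentum_le_exp hP hϑ0 (N + 1) y _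
  have hCb : ∀ y, |C y| ≤ 2 / (1 / (4 * T)) * Real.exp (1 / (4 * T) * Hm y) := fun y =>
    abs_sq_momentum_le_exp hP hϑ0 (N + 1) y _
  have hμA : ∫ z, A z ∂μ₀ = T := integral_momentum_sq_gibbsMeasure hω hl.le hβ hT (N + 1) i
  have hμB : ∫ z, B z ∂μ₀ = T := integral_momentum_sq_gibbsMeasure hω hl.le hβ hT (N + 1) 0
  have hμC : ∫ z, C z ∂μ₀ = T := integral_momentum_sq_gibbsMeasure hω hl.le hβ hT (N + 1) (Fin.last N)
  have hinv : ∀ t : ℝ, ∫ z, KA t z ∂μ₀ = T := fun t => by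
    simp only [hKA, hA]; rw [mean_act_sq_momentum hω hl.le hβ hγ hT N i t]; exact hμA
  have hiB : ∀ t : ℝ, Integrable (fun z => B z * KA t z) μ₀ := fun t =>
    integrable_mul_act hω hl.le hβ hγ hT hBc hAc hBb hAb t.toNNReal
  have hiC : ∀ t : ℝ, Integrable (fun z => C z * KA t z) μ₀ := fun t =>
    integrable_mul_act hω hl.le hβ hγ hT hCc hAc hCb hAb t.toNNReal
  -- the KDN integrand is `Y - X`
  have hptw : ∀ t : ℝ, ∫ z, ((z.2 0) ^ 2 - (z.2 (Fin.last N)) ^ 2) * KA t z ∂μ₀ = Y t - X t := by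
    intro t
    have e : ∀ z : PhaseSpace (N + 1), ((z.2 0) ^ 2 - (z.2 (Fin.last N)) ^ 2) * KA t z =
        B z * KA t z - C z * KA t z := fun z => by simp only [hB, hC]; ring
    rw [integral_congr_ae (Eventually.of_forall e), integral_sub (hiB t) (hiC t)]
    simp only [hX, hY]
    rw [hinv, hμB, hμC]
    ring
  have hval : (∫ s in Ioi (0 : ℝ), ∫ z, ((z.2 0) ^ 2 - (z.2 (Fin.last N)) ^ 2) * KA s z ∂μ₀) =
      (∫ t in Ioi (0:ℝ), Y t) - ∫ t in Ioi (0:ℝ), X t := by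
    rw [← integral_sub hYint hXint]
    exact setIntegral_congr_fun measurableSet_Ioi fun t _ => hptw t
  have hT0 : T ≠ 0 := hT.ne'
  have hγ0 : γ ≠ 0 := hγ.ne'
  have hlim : γ / (2 * T ^ 2) * (∫ s in Ioi (0 : ℝ), ∫ z, ((z.2 0) ^ 2 - (z.2 (Fin.last N)) ^ 2) * KA s z ∂μ₀) =
      γ / T ^ 2 * (∫ t in Ioi (0 : ℝ), Y t) - 1 / 2 := by
    rw [hval]
    have hXv : (∫ t in Ioi (0:ℝ), X t) = T ^ 2 / γ - ∫ t in Ioi (0:ℝ), Y t := by linarith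
    rw [hXv]
    field_simp
    ring
  rw [← hlim]
  refine h.congr' (Eventually.of_forall fun δ => ?_)
  simp only [hTT]

end Summit.AtomisticToContinuum.FouriersLaw.Cruxes.BoundedResponseConverges.ComonotoneLocalResistance.Kernel

end
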